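import Summits.BirchSwinnertonDyer.Rank1Residual.P2.CongruentNumberThetaStarTowers
import HarnessLib
import HarnessLib.Audit.Tags

/-!
# Cell «bsd-monsky» (prover-B): 𝒮⁻-TOWERS — the genus class numbers of the blocks `2z` and `q·z` of `n = 2·q·p₁⋯p_m`, for every
# `m` (towards the kernel statement «Tian–Yuan–Zhang's Thm. 1.2 is SILENT on the one-mark towers»; Rédei kernels by hand, nothing asserted)

HONEST FRAMING (cell `bsd-monsky`, run/shared/lean/pub/bsd-monsky/; README §1/§3): «ℓ ≥ 3 rungs are NOT claimed — record what the same
argument gives there, no more». The record `P2/CongruentNumberThetaStar{Config,Family,BSD,Towers,TowersBSD}.lean` proves Monsky's (a)+(b)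
shape on the 𝒮⁻-towers for every number of prime factors. That Tian–Yuan–Zhang's Thm. 1.2 (the only printed criterion for `n ≡ 6 (mod
8)`) is SILENT there — its second genus sum `Σ₂′(n)` is EVEN — was so far a census statement (kit j252342 / j253031). The companion
`…ThetaStarSilent.lean` makes it a kernel theorem; THIS FILE supplies the `g`-parities it needs, uniformly in `m`, on top of
`…ThetaStarConfig` (row-sum kernels): with `P = p₁⋯p_m` (`pᵢ ≡ 5 (mod 8)` pairwise quadratic residues), `q ≡ 3 (mod 4)`, `μᵢ = [(pᵢ/q) = −1]`:
* `g(2z)` is ODD for every `z ∣ P` (`RM(−8z)`: row and column of `2` all ones — `(−2/pᵢ) = −1`, `pᵢ ≡ 5 (mod 8)` —, `pᵢ`–`pⱼ` entries `0`;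
  kernel `{0, 𝟙}`): `gBitCfgTwo_fiveClique_eq_one`, `odd_gK_two_mul_of_dvd_prod_five`;
* `g(qz)` is ODD when every prime of `z` is marked (`RM(−qz)`: `q`–`pᵢ` entries `μᵢ = 1`; rows `v_i + v_q = 0`): `gBitCfg_qBlock_eq_one`,
  `odd_gK_q_mul_marked`; and EVEN as soon as `z` has an UNMARKED prime `pᵢ` (its indicator is a kernel vector): `gBitCfg_qBlock_eq_zero`,
  `even_gK_q_mul_of_unmarked`.
(The pure blocks — `g(z)` even for `z ≡ 1 (mod 8)`, `z > 1` — and `g(n)` odd are in `…ThetaStarFamily` / `…ThetaStarTowers`; `g(q)` odd is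
`odd_genusClassNumber_genusField_prime`.) `𝔽₂`-linear algebra + Rédei–Reichardt (a tree theorem); no `decide` on patterns, no definition,
nothing asserted; NOT refereed, not part of PROOF-B v1.3 or of the paper.

References: [LiMa2008] Lemma 0.1, Def. 0.2 (p. 279), Thm. 0.4 (p. 280); [Stevenhagen1995RedeiMatrices] §2 Thm. 1; [IrelandRosen1990] Ch. 5 §1
Prop. 5.1.2–5.1.3, §2 Thm. 1; [TianYuanZhang2017] §1 (g(d)), Thm. 1.2; HOME/proof/PROOF-B-THETA-STAR.md §3/§7.
-/

noncomputable section

open scoped Classical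

open Matrix Finset Literature.NumberTheory.EllipticCurves.TianYuanZhang2017
  Literature.NumberTheory.EllipticCurves.TianYuanZhang2017.W2
  Literature.NumberTheory.EllipticCurves.HeathBrown1994
  Literature.NumberTheory.QuadraticFields.RedeiReichardt

set_option autoImplicit false

namespace Summit.BirchSwinnertonDyer.Rank1Residual.P2

namespace ThetaDescent

variable {m : ℕ} {q : ℕ} {p : Fin m → ℕ}

/-! ## §1 Configuration lemmas (every size) -/

/-- **`g(2·p_{i₁}⋯p_{i_s})` is ODD** for pairwise-residue primes `≡ 5 (mod 8)`, every `s ≥ 0`: in `RM(−8z)` (`D₂ = −8`, `z ≡ 1 (mod 4)`) the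
row and the column of `2` are all ones (`[(−2/pᵢ) = −1] = 1`, `[(pᵢ/2) = −1] = 1`) and the `pᵢ`–`pⱼ` entries vanish, so every row
`pᵢ` reads `v_i + v_2 = 0`: kernel `{0, 𝟙}`, `gBitCfgTwo = 1`. [cite: LiMa2008, Thm. 0.4 (p. 280) with Lemma 0.1, Def. 0.2 (p. 279)] -/
theorem gBitCfgTwo_fiveClique_eq_one (r : Fin m → ℕ) (hr : ∀ i, r i = 5) (β : Fin m → Fin m → ZMod 2)
    (hβ : ∀ a b, a ≠ b → β a b = 0) : gBitCfgTwo r β = 1 := by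
  have h4 : (∏ i, r i) % 4 = 1 := by
    have h5 : ∏ i, r i = 5 ^ m := by rw [Finset.prod_congr rfl fun i _ => hr i, Fin.prod_const]
    rw [h5, Nat.pow_mod]; norm_num
  have hE_sN : ∀ a : Fin m, redeiEntryCfgTwo r β (some a) none = 1 := by
    intro a; simp only [redeiEntryCfgTwo, if_pos h4, hr a]; decide
  have hE_ss : ∀ a b : Fin m, a ≠ b → redeiEntryCfgTwo r β (some a) (some b) = 0 := by
    intro a b hab
    simp only [redeiEntryCfgTwo, redeiEntryCfg, hβ a b hab, hr a, hr b]
    simp [chi4Bit]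
  have eq_of_add : ∀ x y : ZMod 2, x + y = 0 → x = y := by decide
  unfold gBitCfgTwo
  rw [if_pos]
  unfold redeiCfgTwo
  apply card_ker_rowsum_eq_two
  intro v hv
  have hs : ∀ a : Fin m, v (some a) = v none := by
    intro a
    have h := hv (some a)
    rw [Fintype.sum_option, hE_sN, one_mul] at h
    have hrest : ∑ b : Fin m, redeiEntryCfgTwo r β (some a) (some b) * (v (some a) + v (some b)) = 0 := by
      refine Finset.sum_eq_zero fun b _ => ?_
      by_cases hab : a = b
      · subst hab; rw [CharTwo.add_self_eq_zero, mul_zero]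
      · rw [hE_ss a b hab, zero_mul]
    rw [hrest, add_zero] at h
    exact eq_of_add _ _ h
  have hall : ∀ c : Option (Fin m), v c = v none := by
    rintro (_ | c)
    · rfl
    · exact hs c
  intro c d
  rw [hall c, hall d]

/-- **`g(q·p_{i₁}⋯p_{i_s})` is ODD when every `p_{i_j}` is a non-residue mod `q`** (`q ≡ 3 (mod 4)`): in `RM(−qz)` (`qz ≡ 3 (mod 4)`, no prime
`2`) the `q`–`pᵢ` entries are `1` and the `pᵢ`–`pⱼ` entries `0`, so every row `pᵢ` reads `v_i + v_q = 0`: kernel `{0, 𝟙}`.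
[cite: LiMa2008, Thm. 0.4 (p. 280) with Lemma 0.1, Def. 0.2 (p. 279)] -/
theorem gBitCfg_qBlock_eq_one (r : Fin (m + 1) → ℕ) (hr0 : r 0 = 3 ∨ r 0 = 7) (hrs : ∀ i : Fin m, r i.succ = 5)
    (β : Fin (m + 1) → Fin (m + 1) → ZMod 2) (hs0 : ∀ i : Fin m, β i.succ 0 = 1)
    (hss : ∀ i j : Fin m, i ≠ j → β i.succ j.succ = 0) : gBitCfg r β = 1 := by
  have h4 : ¬ (∏ i, r i) % 4 = 1 := by
    rw [Fin.prod_univ_succ]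
    have h5 : ∏ i : Fin m, r i.succ = 5 ^ m := by rw [Finset.prod_congr rfl fun i _ => hrs i, Fin.prod_const]
    rw [h5, Nat.mul_mod, Nat.pow_mod]
    rcases hr0 with h | h <;> rw [h] <;> norm_num
  have hE_s0 : ∀ i : Fin m, redeiEntryCfg r β i.succ 0 = 1 := by
    intro i
    simp only [redeiEntryCfg, hs0 i, hrs i]
    rcases hr0 with h | h <;> rw [h] <;> decide
  have hE_ss : ∀ i j : Fin m, i ≠ j → redeiEntryCfg r β i.succ j.succ = 0 := by
    intro i j hij
    simp only [redeiEntryCfg, hss i j hij, hrs i, hrs j]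
    decide
  have eq_of_add : ∀ x y : ZMod 2, x + y = 0 → x = y := by decide
  unfold gBitCfg
  rw [if_neg h4, if_pos]
  unfold redeiCfgOdd
  apply card_ker_rowsum_eq_two
  intro v hv
  have hs : ∀ i : Fin m, v i.succ = v 0 := by
    intro i
    have h := hv i.succ
    rw [Fin.sum_univ_succ, hE_s0, one_mul] at h
    have hrest : ∑ j : Fin m, redeiEntryCfg r β i.succ j.succ * (v i.succ + v j.succ) = 0 := by
      refine Finset.sum_eq_zero fun j _ => ?_
      by_cases hij : i = j
      · subst hij; rw [CharTwo.add_self_eq_zero, mul_zero]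
      · rw [hE_ss i j hij, zero_mul]
    rw [hrest, add_zero] at h
    exact eq_of_add _ _ h
  have hall : ∀ c : Fin (m + 1), v c = v 0 := fun c => Fin.cases rfl (fun i => hs i) c
  intro c d
  rw [hall c, hall d]

/-- **`g(q·p_{i₁}⋯p_{i_s})` is EVEN when some `p_{i₀}` is a residue mod `q`** (`q ≡ 3 (mod 4)`, bits `β 0 i⁺ = β i⁺ 0 = μ i`, `pᵢ`–`pⱼ` entries
`0`, `μ i₀ = 0`): the indicator of `p_{i₀}` is a non-constant kernel vector of `RM(−qz)` (row `q`: `Σ μ_j v_j = μ_{i₀} = 0`; row `pᵢ`: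
`μᵢ v_i = 0`). [cite: LiMa2008, Thm. 0.4 (p. 280) with Lemma 0.1, Def. 0.2 (p. 279)] -/
theorem gBitCfg_qBlock_eq_zero (r : Fin (m + 1) → ℕ) (hr0 : r 0 = 3 ∨ r 0 = 7) (hrs : ∀ i : Fin m, r i.succ = 5)
    (β : Fin (m + 1) → Fin (m + 1) → ZMod 2) (μ : Fin m → ZMod 2) (h0s : ∀ i : Fin m, β 0 i.succ = μ i)
    (hs0 : ∀ i : Fin m, β i.succ 0 = μ i) (hss : ∀ i j : Fin m, i ≠ j → β i.succ j.succ = 0) {i₀ : Fin m} (hi₀ : μ i₀ = 0) :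
    gBitCfg r β = 0 := by
  have h4 : ¬ (∏ i, r i) % 4 = 1 := by
    rw [Fin.prod_univ_succ]
    have h5 : ∏ i : Fin m, r i.succ = 5 ^ m := by rw [Finset.prod_congr rfl fun i _ => hrs i, Fin.prod_const]
    rw [h5, Nat.mul_mod, Nat.pow_mod]
    rcases hr0 with h | h <;> rw [h] <;> norm_num
  have hE_0s : ∀ i : Fin m, redeiEntryCfg r β 0 i.succ = μ i := by
    intro i
    simp only [redeiEntryCfg, h0s i, hrs i]
    rcases hr0 with h | h <;> rw [h] <;> simp [chi4Bit]
  have hE_s0 : ∀ i : Fin m, redeiEntryCfg r β i.succ 0 = μ i := by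
    intro i
    simp only [redeiEntryCfg, hs0 i, hrs i]
    rcases hr0 with h | h <;> rw [h] <;> simp [chi4Bit]
  have hE_ss : ∀ i j : Fin m, i ≠ j → redeiEntryCfg r β i.succ j.succ = 0 := by
    intro i j hij
    simp only [redeiEntryCfg, hss i j hij, hrs i, hrs j]
    decide
  unfold gBitCfg
  rw [if_neg h4, if_neg]
  unfold redeiCfgOdd
  refine card_ker_rowsum_ne_two (redeiEntryCfg r β) (fun c => if c = i₀.succ then 1 else 0) (fun c => ?_)
    (a := i₀.succ) (b := 0) (by rw [if_pos rfl, if_neg (Fin.succ_ne_zero i₀).symm]; exact one_ne_zero)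
  refine Fin.cases ?_ (fun i => ?_) c
  · -- the row of `q`: `Σ_j μ_j · v_j = μ_{i₀} = 0`
    rw [Fin.sum_univ_succ, CharTwo.add_self_eq_zero, mul_zero, zero_add]
    simp only [hE_0s, if_neg (Fin.succ_ne_zero _).symm, zero_add]
    rw [Finset.sum_eq_single i₀ (fun j _ hj => by rw [if_neg (fun h => hj (Fin.succ_injective _ h)), mul_zero])
      (fun h => absurd (mem_univ i₀) h), if_pos rfl, hi₀, zero_mul]
  · -- the row of `pᵢ`: `μᵢ (v_i + 0) + 0 = μᵢ v_i`
    rw [Fin.sum_univ_succ, hE_s0, if_neg (Fin.succ_ne_zero _).symm, add_zero]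
    have hrest : ∑ j : Fin m, redeiEntryCfg r β i.succ j.succ *
        ((if i.succ = i₀.succ then (1 : ZMod 2) else 0) + if j.succ = i₀.succ then 1 else 0) = 0 := by
      refine Finset.sum_eq_zero fun j _ => ?_
      by_cases hij : i = j
      · subst hij; rw [CharTwo.add_self_eq_zero, mul_zero]
      · rw [hE_ss i j hij, zero_mul]
    rw [hrest, add_zero]
    by_cases hii : i = i₀
    · subst hii; rw [hi₀, zero_mul]
    · rw [if_neg (fun h => hii (Fin.succ_injective _ h)), mul_zero]

/-! ## §2 The blocks `2z` and `q·z` of the tower type -/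

/-- Enumerating a divisor `z ∣ p₁⋯p_m` by the `pᵢ` dividing it: `z = ∏_{j} p_{e j}` for an injective `e : Fin s → Fin m` whose image is
`{i : pᵢ ∣ z}`. [cite: HardyWright2008, §1.3 Thm. 2, §17.8] -/
theorem exists_enum_of_dvd_prod_five (hp : ∀ i, (p i).Prime) (hinj : Function.Injective p) {z : ℕ} (hz : z ∣ ∏ i, p i) :
    ∃ (s : ℕ) (e : Fin s → Fin m), Function.Injective e ∧ (∀ i, p i ∣ z ↔ ∃ j, e j = i) ∧ ∏ j, p (e j) = z := by
  set T : Finset (Fin m) := univ.filter fun i => p i ∣ z with hT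
  have hzT : z = ∏ i ∈ T, p i := by
    apply Nat.dvd_antisymm
    · have hsplit : (∏ i ∈ T, p i) * ∏ i ∈ univ.filter (fun i => ¬ p i ∣ z), p i = ∏ i, p i :=
        Finset.prod_filter_mul_prod_filter_not univ (fun i => p i ∣ z) p
      have hcop : Nat.Coprime z (∏ i ∈ univ.filter (fun i => ¬ p i ∣ z), p i) :=
        Nat.Coprime.prod_right fun i hi =>
          Nat.coprime_comm.mp ((Nat.Prime.coprime_iff_not_dvd (hp i)).mpr (Finset.mem_filter.mp hi).2)
      exact hcop.dvd_of_dvd_mul_right (hsplit.symm ▸ hz)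
    · rw [← Finset.prod_image (s := T) (f := fun r => r) (g := p) fun i _ j _ h => hinj h]
      exact Finset.prod_primes_dvd z
        (fun r hr => by obtain ⟨i, -, rfl⟩ := Finset.mem_image.mp hr; exact (hp i).prime)
        (fun r hr => by obtain ⟨i, hi, rfl⟩ := Finset.mem_image.mp hr; exact (Finset.mem_filter.mp hi).2)
  refine ⟨T.card, fun j => ((T.equivFin.symm j : T) : Fin m), fun a b h => T.equivFin.symm.injective (Subtype.ext h),
    fun i => ⟨fun hi => ⟨T.equivFin ⟨i, Finset.mem_filter.mpr ⟨mem_univ _, hi⟩⟩, by simp⟩, ?_⟩, ?_⟩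
  · rintro ⟨j, rfl⟩
    exact (Finset.mem_filter.mp (T.equivFin.symm j).2).2
  · rw [hzT, ← Finset.prod_coe_sort T]
    exact Fintype.prod_equiv T.equivFin.symm _ (fun x => p x) (fun j => rfl)

/-- **`g(2z)` is ODD for every divisor `z` of `p₁⋯p_m`** (`pᵢ ≡ 5 (mod 8)` pairwise quadratic residues), every `m`.
[cite: LiMa2008, Thm. 0.4 (p. 280)] [cite: TianYuanZhang2017, §1 (p0002 L78–L82: g(d))] -/
theorem odd_gK_two_mul_of_dvd_prod_five (hp : ∀ i, (p i).Prime) (hp5 : ∀ i, p i % 8 = 5) (hinj : Function.Injective p)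
    (hQR : ∀ i j, i ≠ j → kroneckerBit (p j) (p i) = 0) {z : ℕ} (hz : z ∣ ∏ i, p i) : Odd (gK (2 * z)) := by
  obtain ⟨s, e, he, -, hprod⟩ := exists_enum_of_dvd_prod_five hp hinj hz
  have key := natCast_genusClassNumber_two_mul_eq_gBitCfgTwo redeiReichardt_fourTwoCard_classGroup_holds (fun j => p (e j))
    (fun j => hp (e j)) (fun j => by have := hp5 (e j); omega) (hinj.comp he)
  rw [hprod, gBitCfgTwo_fiveClique_eq_one _ (fun j => hp5 (e j)) _
    (fun a b hab => hQR (e a) (e b) fun h => hab (he h))] at key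
  unfold gK
  exact ZMod.natCast_eq_one_iff_odd.mp key

/-- **`g(q·z)` is EVEN if `z ∣ p₁⋯p_m` has a prime factor `p_{i₀}` that is a residue mod `q`** (`q ≡ 3 (mod 4)`), every `m`.
[cite: LiMa2008, Thm. 0.4 (p. 280)] [cite: IrelandRosen1990, Ch. 5 §2 Thm. 1] [cite: TianYuanZhang2017, §1 (p0002 L78–L82: g(d))] -/
theorem even_gK_q_mul_of_unmarked (hq : q.Prime) (hq4 : q % 4 = 3) (hp : ∀ i, (p i).Prime) (hp5 : ∀ i, p i % 8 = 5)
    (hinj : Function.Injective p) (hQR : ∀ i j, i ≠ j → kroneckerBit (p j) (p i) = 0) {z : ℕ} (hz : z ∣ ∏ i, p i)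
    {i₀ : Fin m} (hi₀z : p i₀ ∣ z) (hi₀ : kroneckerBit (p i₀) q = 0) : Even (gK (q * z)) := by
  have hq2 : q ≠ 2 := by omega
  obtain ⟨s, e, he, hmem, hprod⟩ := exists_enum_of_dvd_prod_five hp hinj hz
  obtain ⟨j₀, hj₀⟩ := (hmem i₀).mp hi₀z
  have hP2 : ∀ i, (vecCons q (fun j => p (e j)) : Fin (s + 1) → ℕ) i ≠ 2 := fun i h2 => by
    have h := star_cons_odd' (q := q) (p := fun j => p (e j)) hq4 (fun j => hp5 (e j)) i
    rw [h2] at h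
    exact (Nat.not_odd_iff_even.mpr even_two) h
  have key := natCast_genusClassNumber_eq_gBitCfg redeiReichardt_fourTwoCard_classGroup_holds
    (vecCons q (fun j => p (e j)) : Fin (s + 1) → ℕ) (star_cons_prime hq fun j => hp (e j)) hP2
    (star_cons_injective' hq4 (fun j => hp5 (e j)) (hinj.comp he))
  rw [prod_star_cons, hprod] at key
  have hcfg : gBitCfg (fun i => (vecCons q (fun j => p (e j)) : Fin (s + 1) → ℕ) i % 8)
      (fun a b => kroneckerBit ((vecCons q (fun j => p (e j)) : Fin (s + 1) → ℕ) b)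
        ((vecCons q (fun j => p (e j)) : Fin (s + 1) → ℕ) a)) = 0 := by
    refine gBitCfg_qBlock_eq_zero _ (by simp; omega) (fun j => by simp [hp5 (e j)]) _ (fun j => kroneckerBit (p (e j)) q)
      (fun j => by simp) (fun j => ?_) (fun i j hij => by simp only [cons_val_succ]; exact hQR (e i) (e j) fun h => hij (he h))
      (i₀ := j₀) (by rw [hj₀]; exact hi₀)
    have hpj2 : p (e j) ≠ 2 := by have := hp5 (e j); omega
    have hne : q ≠ p (e j) := fun h => by have := hp5 (e j); omega
    simp only [cons_val_succ, cons_val_zero]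
    rw [kroneckerBit_swap hq (hp (e j)) hq2 hpj2 hne]
    simp [chi4Bit, hq4, show p (e j) % 4 = 1 by have := hp5 (e j); omega]
  rw [hcfg] at key
  unfold gK
  exact ZMod.natCast_eq_zero_iff_even.mp key

/-- **`g(q·p_a)` is ODD for the marked prime `p_a`** (`(p_a/q) = −1`, `q ≡ 3 (mod 4)`).
[cite: LiMa2008, Thm. 0.4 (p. 280)] [cite: IrelandRosen1990, Ch. 5 §2 Thm. 1] [cite: TianYuanZhang2017, §1 (p0002 L78–L82: g(d))] -/
theorem odd_gK_q_mul_marked (hq : q.Prime) (hq4 : q % 4 = 3) (hp : ∀ i, (p i).Prime) (hp5 : ∀ i, p i % 8 = 5)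
    {a : Fin m} (ha : kroneckerBit (p a) q = 1) : Odd (gK (q * p a)) := by
  have hq2 : q ≠ 2 := by omega
  have hpa2 : p a ≠ 2 := by have := hp5 a; omega
  have hne : q ≠ p a := fun h => by have := hp5 a; omega
  have hP2 : ∀ i, (vecCons q (fun _ : Fin 1 => p a) : Fin 2 → ℕ) i ≠ 2 := fun i h2 => by
    have h := star_cons_odd' (q := q) (p := fun _ : Fin 1 => p a) hq4 (fun _ => hp5 a) i
    rw [h2] at h
    exact (Nat.not_odd_iff_even.mpr even_two) h
  have hinj1 : Function.Injective (fun _ : Fin 1 => p a) := fun i j _ => Subsingleton.elim i j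
  have key := natCast_genusClassNumber_eq_gBitCfg redeiReichardt_fourTwoCard_classGroup_holds
    (vecCons q (fun _ : Fin 1 => p a) : Fin 2 → ℕ) (star_cons_prime hq fun _ => hp a) hP2
    (star_cons_injective' hq4 (fun _ => hp5 a) hinj1)
  rw [prod_star_cons, Fin.prod_univ_one] at key
  have hcfg : gBitCfg (fun i => (vecCons q (fun _ : Fin 1 => p a) : Fin 2 → ℕ) i % 8)
      (fun x y => kroneckerBit ((vecCons q (fun _ : Fin 1 => p a) : Fin 2 → ℕ) y)
        ((vecCons q (fun _ : Fin 1 => p a) : Fin 2 → ℕ) x)) = 1 := by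
    refine gBitCfg_qBlock_eq_one _ (by simp; omega) (fun j => by simp [hp5 a]) _ (fun j => ?_)
      (fun i j hij => absurd (Subsingleton.elim i j) hij)
    simp only [cons_val_succ, cons_val_zero]
    rw [kroneckerBit_swap hq (hp a) hq2 hpa2 hne, ha]
    simp [chi4Bit, hq4, show p a % 4 = 1 by have := hp5 a; omega]
  rw [hcfg] at key
  unfold gK
  exact ZMod.natCast_eq_one_iff_odd.mp key

end ThetaDescent

end Summit.BirchSwinnertonDyer.Rank1Residual.P2

end
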